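import Mathlib
import HarnessLib
import Summits.Ventures.LatticeQCDFlow.Exactness.NCMCGeneralSpaceOccupancyTauIntLowerBound

/-!
# The MIRROR floor for the NCMC lane's `τ_int`: `τ_int(ρ_occ) ≥ (1 − σ) ρ₁² / (2 (1 + ρ₁))` from TARGET-level regeneration with a rejected REVERSE switch, and the two-sided floor `max(σρ₀²/(2(1+ρ₀)), (1−σ)ρ₁²/(2(1+ρ₁)))`

HONEST FRAMING: exact (Metropolis-corrected) sampling algorithms for lattice gauge theory;
figures of merit are autocorrelation/cost numbers at stated couplings and volumes; no
continuum-physics claim.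

Venture `LatticeQCDFlow` (cell pub-lqcd), topic `Exactness`; FANOUT row 13 (`eng-snf`, GEN-21).
NEW WORK of the cell, not a published result; no definition is introduced; nothing is cited as a
fact.  Mirror of GEN-21's `NCMCGeneralSpaceOccupancyTauIntLowerBound` (prior-level regeneration,
`σ ρ₀²/(2(1+ρ₀))`, vacuous when the forward switch is never rejected — possible for `c > ΔF`): from a
TARGET state, relax into `m₁ ≤ T₁(y, ·)` and have the REVERSE switch rejected (GEN-18's
`rejTarget_le_iteration`); on that branch the Poisson solution takes the value `u(y') = h(target, y')`
while `Qh(target, y) = u(y) − (1 − σ)`, and the same double-integral inequality gives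
`σ²_occ ≥ σ (1 − σ)² ρ₁²/(1 + ρ₁)`, i.e. `τ_int(ρ_occ) ≥ (1 − σ) ρ₁²/(2(1 + ρ₁))` — positive as soon
as the reverse switch is rejected with positive `m₁`-mass (automatic for `c > ΔF` by the Jarzynski
sign, GEN-18 `NCMCGeneralSpaceOccupancyChainDoeblinMirror`).

## Content

* `withDensity_rejT_le`, `withDensity_rejT_univ`, `integral_jointLaw_ge_target`
  (`Z⁻¹ e^{c} ∫ g(target, y) dν₁ ≤ ∫ g dπ_c` for `g ≥ 0`), `integral_rejectedT_sq_le` (the rejected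
  reverse branch of the conditional variance at a target state).
* **`CrooksPair.ncmc_tauInt_occupancy_ge_target_of_nHit`** — the mirror floor.
* **`CrooksPair.ncmc_tauInt_occupancy_ge_max_of_nHit`** — both level samplers minorised
  (`m₀ ≤ T₀`, `m₁ ≤ T₁`): `max (σρ₀²/(2(1+ρ₀))) ((1−σ)ρ₁²/(2(1+ρ₁))) ≤ τ_int(ρ_occ)`.

NOT CLAIMED: sharpness; anything numerical.
-/

namespace Summit.Ventures.LatticeQCDFlow.Exactness.GeneralNCMC

open MeasureTheory ProbabilityTheory Set Filter Finset
open scoped ENNReal NNReal Topology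

/-! ## §1 Target-level bookkeeping -/

section Lane

variable {Ω E : Type*} [MeasurableSpace Ω] [MeasurableSpace E]
  {κF κR : Kernel Ω E} [IsMarkovKernel κF] [IsMarkovKernel κR] {c : ℝ} {W : E → ℝ} {s e : E → Ω}

omit [IsMarkovKernel κR] in
/-- The rejected reverse mass measure `(1 − R_c) m₁` lies below `m₁`. -/
theorem withDensity_rejT_le (m₁ : Measure Ω) :
    (m₁.withDensity fun y' => 1 - revFlow κR c W s y' univ) ≤ m₁ := by
  have h1 : (fun y' => 1 - revFlow κR c W s y' univ) ≤ᵐ[m₁] fun _ => (1 : ℝ≥0∞) :=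
    ae_of_all _ fun y' => by
      show 1 - revFlow κR c W s y' univ ≤ 1
      exact tsub_le_self
  calc (m₁.withDensity fun y' => 1 - revFlow κR c W s y' univ) ≤ m₁.withDensity fun _ => 1 :=
        withDensity_mono h1
    _ = m₁ := withDensity_one

omit [IsMarkovKernel κR] in
/-- Its total mass is `ρ₁ = ∫ (1 − R_c(y', Ω)) dm₁`. -/
theorem withDensity_rejT_univ (m₁ : Measure Ω) :
    (m₁.withDensity fun y' => 1 - revFlow κR c W s y' univ) univ
      = ∫⁻ y', (1 - revFlow κR c W s y' univ) ∂m₁ := by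
  rw [withDensity_apply _ MeasurableSet.univ, Measure.restrict_univ]

/-- **Restriction to the target level**: for `g ≥ 0` bounded measurable,
`Z⁻¹ (e^{c} ∫ g(target, y) dν₁) ≤ ∫ g dπ_c`. -/
theorem integral_jointLaw_ge_target (c : ℝ) (ν₀ ν₁ : Measure Ω) [IsFiniteMeasure ν₀]
    [IsFiniteMeasure ν₁] {g : Bool × Ω → ℝ} (hg : Measurable g) (hg0 : ∀ z, 0 ≤ g z) {Cg : ℝ}
    (hgb : ∀ z, |g z| ≤ Cg) :
    ((jointWeight c ν₀ ν₁ univ).toReal)⁻¹ * (Real.exp c * ∫ y, g (true, y) ∂ν₁)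
      ≤ ∫ z, g z ∂((jointWeight c ν₀ ν₁ univ)⁻¹ • jointWeight c ν₀ ν₁) := by
  rw [integral_jointLaw, integral_jointWeight_real c ν₀ ν₁ hg
    (Scoring.integrable_of_bounded ν₀ (hg.comp measurable_prodMk_left) fun x => hgb _)
    (Scoring.integrable_of_bounded ν₁ (hg.comp measurable_prodMk_left) fun y => hgb _)]
  have h2 : 0 ≤ ∫ x, g (false, x) ∂ν₀ := integral_nonneg fun x => hg0 _
  exact mul_le_mul_of_nonneg_left (le_add_of_nonneg_left h2) (inv_nonneg.2 ENNReal.toReal_nonneg)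

variable (T₀ T₁ : Kernel Ω Ω) [IsMarkovKernel T₀] [IsMarkovKernel T₁]

/-- **The rejected reverse branch of the conditional variance at a target state.**  If
`m₁ ≤ T₁(y, ·)`, then for every bounded measurable `H` and real `a`:
`∫ (H(target, y') − a)² d((1 − R_c) m₁)(y') ≤ ∫ (H(z) − a)² dQ((target, y), dz)`. -/
theorem integral_rejectedT_sq_le (hW : Measurable W) (hs : Measurable s) (he : Measurable e)
    {m₁ : Measure Ω} {y : Ω} (hmin : m₁ ≤ T₁ y) {H : Bool × Ω → ℝ} (hHm : Measurable H) {CH : ℝ}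
    (hHb : ∀ z, |H z| ≤ CH) (a : ℝ) :
    haveI := isMarkovKernel_switchKernel (κF := κF) (κR := κR) (c := c) hW hs he
    ∫ y', (H (true, y') - a) ^ 2 ∂(m₁.withDensity fun y' => 1 - revFlow κR c W s y' univ)
      ≤ ∫ z, (H z - a) ^ 2 ∂((switchKernel κF κR c W s e ∘ₖ levelKernel T₀ T₁) (true, y)) := by
  haveI := isMarkovKernel_switchKernel (κF := κF) (κR := κR) (c := c) hW hs he
  haveI := isMarkovKernel_levelKernel T₀ T₁
  have hle := rejTarget_le_iteration (κF := κF) (κR := κR) (c := c) (W := W) (s := s) (e := e)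
    T₀ T₁ hW hs hmin
  have hfm : Measurable fun z : Bool × Ω => (H z - a) ^ 2 := (hHm.sub_const _).pow_const 2
  have hfb : ∀ z, |(H z - a) ^ 2| ≤ (CH + |a|) ^ 2 := fun z => by
    rw [abs_pow]
    have h1 : |H z - a| ≤ CH + |a| := (abs_sub (H z) a).trans (by linarith [hHb z])
    exact pow_le_pow_left₀ (abs_nonneg _) h1 2
  calc ∫ y', (H (true, y') - a) ^ 2 ∂(m₁.withDensity fun y' => 1 - revFlow κR c W s y' univ)
      = ∫ z, (H z - a) ^ 2
          ∂((m₁.withDensity fun y' => 1 - revFlow κR c W s y' univ).map (Prod.mk true)) := by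
        rw [integral_map measurable_prodMk_left.aemeasurable hfm.aestronglyMeasurable]
    _ ≤ ∫ z, (H z - a) ^ 2 ∂((switchKernel κF κR c W s e ∘ₖ levelKernel T₀ T₁) (true, y)) :=
        integral_mono_measure hle (ae_of_all _ fun _ => sq_nonneg _)
          (Scoring.integrable_of_bounded _ hfm hfb)

end Lane

/-! ## §2 The mirror floor and the two-sided floor -/

section Floor

variable {Ω E : Type*} [MeasurableSpace Ω] [MeasurableSpace E]
  {ν₀ ν₁ : Measure Ω} [IsFiniteMeasure ν₀] [IsFiniteMeasure ν₁]
  {κF κR : Kernel Ω E} [IsMarkovKernel κF] [IsMarkovKernel κR] {s e : E → Ω} {W : E → ℝ} {c : ℝ}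
  {T₀ T₁ : Kernel Ω Ω} [IsMarkovKernel T₀] [IsMarkovKernel T₁] {ε : ℝ≥0∞} {m : ℕ}
  {ν : Measure (Bool × Ω)} [IsProbabilityMeasure ν]

/-- **THE MIRROR FLOOR FOR THE NCMC LANE'S `τ_int`, from any Doeblin power plus TARGET-level
regeneration.**  Crooks pair, level samplers leaving `ν₀, ν₁` invariant, `ε • ν ≤ (nHit Q m)(z, ·)`
for all `z` (`ε ≠ 0`, `0 < m`), `m₁ ≤ T₁(y, ·)` for all `y` (`m₁` finite), `e^{−ΔF} = Z₁/Z₀`.  With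
`σ = σ(c − ΔF)` and `ρ₁ = (∫⁻ (1 − R_c(y', Ω)) dm₁).toReal` (the `m₁`-averaged REVERSE rejection mass):
`(1 − σ) ρ₁² / (2 (1 + ρ₁)) ≤ Scoring.tauInt (setACF Q π_c target)`. -/
theorem CrooksPair.ncmc_tauInt_occupancy_ge_target_of_nHit (h : CrooksPair ν₀ ν₁ κF κR s e W)
    (h0 : ν₀ univ ≠ 0) (h1 : ν₁ univ ≠ 0) (hT₀ : Kernel.Invariant T₀ ν₀)
    (hT₁ : Kernel.Invariant T₁ ν₁) (hε : ε ≠ 0) (hm : 0 < m)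
    (hD : haveI := isMarkovKernel_switchKernel (κF := κF) (κR := κR) (c := c)
              h.measurable_W h.measurable_s h.measurable_e
      ∀ z, ε • ν ≤ nHit (switchKernel κF κR c W s e ∘ₖ levelKernel T₀ T₁) m z)
    {m₁ : Measure Ω} [IsFiniteMeasure m₁] (hmin₁ : ∀ y, m₁ ≤ T₁ y)
    {ΔF : ℝ} (hΔF : Real.exp (-ΔF) = ((ν₀ univ)⁻¹ * ν₁ univ).toReal) :
    haveI := isMarkovKernel_switchKernel (κF := κF) (κR := κR) (c := c)
      h.measurable_W h.measurable_s h.measurable_e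
    (1 - Real.sigmoid (c - ΔF)) * (∫⁻ y', (1 - revFlow κR c W s y' univ) ∂m₁).toReal ^ 2
        / (2 * (1 + (∫⁻ y', (1 - revFlow κR c W s y' univ) ∂m₁).toReal))
      ≤ Scoring.tauInt (setACF (switchKernel κF κR c W s e ∘ₖ levelKernel T₀ T₁)
          ((jointWeight c ν₀ ν₁ univ)⁻¹ • jointWeight c ν₀ ν₁) (targetLevel Ω)) := by
  haveI := isMarkovKernel_switchKernel (κF := κF) (κR := κR) (c := c)
    h.measurable_W h.measurable_s h.measurable_e
  haveI := isMarkovKernel_levelKernel T₀ T₁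
  haveI := isProbabilityMeasure_jointLaw c ν₀ ν₁ h0
  haveI := isFiniteMeasure_jointWeight c ν₀ ν₁
  haveI : Nonempty (Bool × Ω) :=
    nonempty_of_isProbabilityMeasure ((jointWeight c ν₀ ν₁ univ)⁻¹ • jointWeight c ν₀ ν₁)
  set Q := switchKernel κF κR c W s e ∘ₖ levelKernel T₀ T₁ with hQ
  set πc : Measure (Bool × Ω) := (jointWeight c ν₀ ν₁ univ)⁻¹ • jointWeight c ν₀ ν₁ with hπc
  set σ : ℝ := Real.sigmoid (c - ΔF) with hσdef
  -- the rejected-mass measure and its total mass `ρ`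
  set A : Measure Ω := m₁.withDensity fun y' => 1 - revFlow κR c W s y' univ with hA
  have hAle : A ≤ m₁ := withDensity_rejT_le m₁
  haveI : IsFiniteMeasure A := by
    refine ⟨lt_of_le_of_lt ?_ (measure_lt_top m₁ univ)⟩
    exact Measure.le_iff'.1 hAle univ
  have hAuniv : A univ = ∫⁻ y', (1 - revFlow κR c W s y' univ) ∂m₁ := withDensity_rejT_univ m₁
  set ρ : ℝ := (∫⁻ y', (1 - revFlow κR c W s y' univ) ∂m₁).toReal with hρdef
  have hρA : A.real univ = ρ := by rw [measureReal_def, hAuniv]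
  have hρ0 : 0 ≤ ρ := ENNReal.toReal_nonneg
  -- stationary occupancy
  have hσ0 : 0 < σ := Real.sigmoid_pos _
  have hσ1 : σ < 1 := Real.sigmoid_lt_one _
  have hv0 : 0 < σ * (1 - σ) := mul_pos hσ0 (sub_pos.2 hσ1)
  have hπ : Kernel.Invariant Q πc := invariant_smul _ (iteration_invariant h hT₀ hT₁ c) _
  have hσeq : πc.real (targetLevel Ω) = σ := jointLaw_real_targetLevel c ν₀ ν₁ h0 h1 hΔF
  have hp0 : 0 < πc.real (targetLevel Ω) := by rw [hσeq]; exact hσ0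
  have hp1 : πc.real (targetLevel Ω) < 1 := by rw [hσeq]; exact hσ1
  -- Doeblin-power data
  have hε1 : ε ≤ 1 := by
    haveI := isMarkovKernel_nHit Q m
    exact eps_le_one_of_minorised hD
  have hε0 : 0 < ε := pos_iff_ne_zero.2 hε
  have hminS : ∀ z {B : Set (Bool × Ω)}, MeasurableSet B → ε * ν B ≤ nHit Q m z B :=
    fun z B hB => minorised_setwise hD z hB
  -- the occupancy indicator and its Poisson solution
  have hg : Measurable ((targetLevel Ω).indicator (1 : Bool × Ω → ℝ)) :=
    measurable_one.indicator measurableSet_targetLevel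
  have hgb : ∀ y, |(targetLevel Ω).indicator (1 : Bool × Ω → ℝ) y| ≤ 1 := fun y => by
    by_cases hy : y ∈ targetLevel Ω <;> simp [hy]
  have hmean : ∫ z, (targetLevel Ω).indicator (1 : Bool × Ω → ℝ) z ∂πc = σ := by
    rw [integral_indicator_one measurableSet_targetLevel, hσeq]
  obtain ⟨hfb, hCfb, hfb0⟩ := Scoring.centred_observable_bounds πc hg hgb
  obtain ⟨H, hHm, hHb, hpois⟩ := poisson_exists_of_nHit hminS hε0 hε1 hm hπ hfb hCfb hfb0
  have hGK := integral_sq_sub_sq_kop_eq_greenKubo_of_nHit hminS hε0 hε1 hm hπ hfb hCfb hfb0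
    hHm hHb hpois
  set CH : ℝ := 2 * (2 * 1) * (m : ℕ) / ε.toReal with hCH
  -- `σ²_occ = 2 τ σ (1 − σ)`
  have hσ2 : ∫ z, H z ^ 2 ∂πc - ∫ z, (Scoring.kop Q H z) ^ 2 ∂πc
      = 2 * Scoring.tauInt (setACF Q πc (targetLevel Ω)) * (σ * (1 - σ)) := by
    rw [hGK, ← hσeq, ← greenKubo_indicator_eq_tauInt hπ measurableSet_targetLevel hp0 hp1]
    unfold Scoring.autocov
    rfl
  set τ : ℝ := Scoring.tauInt (setACF Q πc (targetLevel Ω)) with hτdef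
  -- `Qh(target, y) = u(y) − (1 − σ)`
  have ha : ∀ y, Scoring.kop Q H (true, y) = H (true, y) - (1 - σ) := by
    intro y
    have hy := hpois (true, y)
    rw [hmean, Set.indicator_of_mem (by simp [targetLevel] : (true, y) ∈ targetLevel Ω),
      Pi.one_apply] at hy
    linarith only [hy]
  -- (i) `σ²_occ = ∫ q dπ_c`, `q = Q(H²) − (QH)² ≥ 0` bounded measurable
  obtain ⟨hKm, hKb⟩ := Scoring.iterate_kop_bounded_measurable Q hHm hHb 1
  simp only [Function.iterate_one] at hKm hKb
  have hqm : Measurable fun z => Scoring.kop Q (fun y => H y ^ 2) z - (Scoring.kop Q H z) ^ 2 :=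
    (Scoring.measurable_kop Q (hHm.pow_const 2)).sub (hKm.pow_const 2)
  have hqb : ∀ z, |Scoring.kop Q (fun y => H y ^ 2) z - (Scoring.kop Q H z) ^ 2| ≤ CH ^ 2 + CH ^ 2 :=
    fun z => (abs_sub _ _).trans (add_le_add
      (Scoring.abs_kop_le Q (fun y => by
        rw [abs_pow]; exact pow_le_pow_left₀ (abs_nonneg _) (hHb y) 2) z)
      (by rw [abs_pow]; exact pow_le_pow_left₀ (abs_nonneg _) (hKb z) 2))
  have h_i : ∫ z, H z ^ 2 ∂πc - ∫ z, (Scoring.kop Q H z) ^ 2 ∂πc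
      = ∫ z, (Scoring.kop Q (fun y => H y ^ 2) z - (Scoring.kop Q H z) ^ 2) ∂πc :=
    (integral_condVar_eq_sq_sub_sq_kop hπ hHm hHb).symm
  -- (ii) restrict to the target level
  have h_ii := integral_jointLaw_ge_target c ν₀ ν₁ hqm (fun z => condVar_nonneg hHm hHb z) hqb
  -- (iii) the rejected branch, pointwise in the prior state
  set u : Ω → ℝ := fun x => H (true, x) with hu
  have hum : Measurable u := hHm.comp measurable_prodMk_left
  have hub : ∀ x, |u x| ≤ CH := fun x => hHb _
  have h_iii : ∀ x, ∫ x', (u x' - u x - (-(1 - σ))) ^ 2 ∂A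
      ≤ Scoring.kop Q (fun y => H y ^ 2) (true, x) - (Scoring.kop Q H (true, x)) ^ 2 := by
    intro x
    rw [kop_sq_sub_sq_eq_integral Q hHm hHb (true, x), ha x]
    have := integral_rejectedT_sq_le (κF := κF) (κR := κR) (c := c) (W := W) (s := s) (e := e)
      T₀ T₁ h.measurable_W h.measurable_s h.measurable_e (hmin₁ x) hHm hHb (H (true, x) - (1 - σ))
    refine le_trans (le_of_eq (integral_congr_ae (ae_of_all _ fun x' => ?_))) this
    show (u x' - u x - (-(1 - σ))) ^ 2 = (H (true, x') - (H (true, x) - (1 - σ))) ^ 2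
    simp only [hu]; ring
  -- (iv) integrate (iii) over `ν₀`; the left side through the expansion of §1
  set P : Measure Ω := (ν₁ univ)⁻¹ • ν₁ with hP
  haveI : IsProbabilityMeasure P :=
    ⟨by rw [hP, Measure.smul_apply, smul_eq_mul, ENNReal.inv_mul_cancel h1 (measure_ne_top _ _)]⟩
  have hAP : A ≤ P := hAle.trans (le_normalised_of_minorised_invariant h1 hT₁ hmin₁)
  set b := ∫ x, u x ∂P with hb
  set J := ∫ x', (u x' - (-(1 - σ)) - b) ^ 2 ∂A with hJ
  set B := ∫ x', (u x' - (-(1 - σ)) - b) ∂A with hB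
  have hexpand : ∀ x, ∫ x', (u x' - u x - (-(1 - σ))) ^ 2 ∂A
      = J - 2 * (u x - b) * B + A.real univ * (u x - b) ^ 2 :=
    fun x => integral_sq_shift_expand A hum hub (-(1 - σ)) b x
  have hFm : Measurable fun x => J - 2 * (u x - b) * B + A.real univ * (u x - b) ^ 2 :=
    ((measurable_const.sub (((hum.sub_const _).const_mul _).mul_const _)).add
      ((hum.sub_const _).pow_const 2 |>.const_mul _))
  have hbd' : ∀ x, |u x - b| ≤ CH + |b| := fun x =>
    (abs_sub _ _).trans (by linarith only [hub x])
  have hFb : ∀ x, |J - 2 * (u x - b) * B + A.real univ * (u x - b) ^ 2|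
      ≤ |J| + 2 * (CH + |b|) * |B| + A.real univ * (CH + |b|) ^ 2 := by
    intro x
    have h1' : |2 * (u x - b) * B| ≤ 2 * (CH + |b|) * |B| := by
      rw [abs_mul, abs_mul, abs_two]
      exact mul_le_mul_of_nonneg_right (mul_le_mul_of_nonneg_left (hbd' x) zero_le_two)
        (abs_nonneg _)
    have h2' : |A.real univ * (u x - b) ^ 2| ≤ A.real univ * (CH + |b|) ^ 2 := by
      rw [abs_mul, abs_of_nonneg (measureReal_nonneg), abs_pow]
      exact mul_le_mul_of_nonneg_left (pow_le_pow_left₀ (abs_nonneg _) (hbd' x) 2) measureReal_nonneg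
    calc |J - 2 * (u x - b) * B + A.real univ * (u x - b) ^ 2|
        ≤ |J - 2 * (u x - b) * B| + |A.real univ * (u x - b) ^ 2| := abs_add_le _ _
      _ ≤ |J| + |2 * (u x - b) * B| + |A.real univ * (u x - b) ^ 2| :=
          add_le_add (abs_sub _ _) le_rfl
      _ ≤ |J| + 2 * (CH + |b|) * |B| + A.real univ * (CH + |b|) ^ 2 := by
          linarith only [h1', h2']
  have h_iv : ∫ x, (J - 2 * (u x - b) * B + A.real univ * (u x - b) ^ 2) ∂ν₁
      ≤ ∫ x, (Scoring.kop Q (fun y => H y ^ 2) (true, x) - (Scoring.kop Q H (true, x)) ^ 2) ∂ν₁ :=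
    integral_mono (Scoring.integrable_of_bounded ν₁ hFm hFb)
      (Scoring.integrable_of_bounded ν₁ (hqm.comp measurable_prodMk_left) fun x => hqb _)
      fun x => by rw [← hexpand x]; exact h_iii x
  -- (v) the elementary inequality under `P`, transported to `ν₀ = Z₀ • P`
  have h_v := sq_mul_sq_le_integral_integral_sq_shift P A hAP hum hub (-(1 - σ))
  simp_rw [hexpand] at h_v
  have hZ0 : ∫ x, (J - 2 * (u x - b) * B + A.real univ * (u x - b) ^ 2) ∂ν₁
      = (ν₁ univ).toReal * ∫ x, (J - 2 * (u x - b) * B + A.real univ * (u x - b) ^ 2) ∂P := by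
    rw [hP, integral_smul_measure, ENNReal.toReal_inv, smul_eq_mul, ← mul_assoc,
      mul_inv_cancel₀ (ENNReal.toReal_ne_zero.2 ⟨h1, measure_ne_top _ _⟩), one_mul]
  -- `Z⁻¹ e^c Z₁ = σ`
  have hZZ : ((jointWeight c ν₀ ν₁ univ).toReal)⁻¹ * (Real.exp c * (ν₁ univ).toReal) = σ := by
    rw [← hσeq, measureReal_def, hπc, Measure.smul_apply, smul_eq_mul, ENNReal.toReal_mul,
      ENNReal.toReal_inv, toReal_jointWeight_targetLevel]
  -- assemble: `σ (1 − σ)² ρ² ≤ (1 + ρ) · 2 τ σ (1 − σ)`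
  have hZinv : 0 ≤ ((jointWeight c ν₀ ν₁ univ).toReal)⁻¹ := inv_nonneg.2 ENNReal.toReal_nonneg
  have hec : 0 ≤ Real.exp c := (Real.exp_pos c).le
  have hmain : σ * (ρ ^ 2 * (1 - σ) ^ 2) ≤ (1 + ρ) * (2 * τ * (σ * (1 - σ))) := by
    rw [hρA] at h_v
    have step1 : Real.exp c * (ν₁ univ).toReal * (ρ ^ 2 * (1 - σ) ^ 2)
        ≤ (1 + ρ) * (Real.exp c * ∫ x, (J - 2 * (u x - b) * B + ρ * (u x - b) ^ 2) ∂ν₁) := by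
      rw [hρA] at hZ0
      rw [hZ0]
      have := mul_le_mul_of_nonneg_left h_v
        (mul_nonneg hec ENNReal.toReal_nonneg : 0 ≤ Real.exp c * (ν₁ univ).toReal)
      have hsq : (-(1 - σ)) ^ 2 = (1 - σ) ^ 2 := by ring
      rw [hsq] at this
      linarith only [this]
    have step2 : ((jointWeight c ν₀ ν₁ univ).toReal)⁻¹
          * (Real.exp c * ∫ x, (J - 2 * (u x - b) * B + ρ * (u x - b) ^ 2) ∂ν₁)
        ≤ 2 * τ * (σ * (1 - σ)) := by
      rw [← hσ2, h_i]
      rw [hρA] at h_iv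
      exact (mul_le_mul_of_nonneg_left (mul_le_mul_of_nonneg_left h_iv hec) hZinv).trans h_ii
    calc σ * (ρ ^ 2 * (1 - σ) ^ 2)
        = ((jointWeight c ν₀ ν₁ univ).toReal)⁻¹
          * (Real.exp c * (ν₁ univ).toReal * (ρ ^ 2 * (1 - σ) ^ 2)) := by
          rw [← hZZ]; ring
      _ ≤ ((jointWeight c ν₀ ν₁ univ).toReal)⁻¹
          * ((1 + ρ) * (Real.exp c * ∫ x, (J - 2 * (u x - b) * B + ρ * (u x - b) ^ 2) ∂ν₁)) :=
          mul_le_mul_of_nonneg_left step1 hZinv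
      _ = (1 + ρ) * (((jointWeight c ν₀ ν₁ univ).toReal)⁻¹
          * (Real.exp c * ∫ x, (J - 2 * (u x - b) * B + ρ * (u x - b) ^ 2) ∂ν₁)) := by ring
      _ ≤ (1 + ρ) * (2 * τ * (σ * (1 - σ))) :=
          mul_le_mul_of_nonneg_left step2 (by linarith only [hρ0])
  -- divide by `2 σ (1 − σ) (1 + ρ) > 0`
  have h2ρ : (0 : ℝ) < 2 * (1 + ρ) := by linarith only [hρ0]
  rw [div_le_iff₀ h2ρ]
  have hmain' : ρ ^ 2 * (1 - σ) ≤ (1 + ρ) * (2 * τ) := by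
    have h' : (σ * (1 - σ)) * (ρ ^ 2 * (1 - σ)) ≤ (σ * (1 - σ)) * ((1 + ρ) * (2 * τ)) := by
      calc (σ * (1 - σ)) * (ρ ^ 2 * (1 - σ)) = σ * (ρ ^ 2 * (1 - σ) ^ 2) := by ring
        _ ≤ (1 + ρ) * (2 * τ * (σ * (1 - σ))) := hmain
        _ = (σ * (1 - σ)) * ((1 + ρ) * (2 * τ)) := by ring
    exact le_of_mul_le_mul_left h' hv0
  calc (1 - σ) * ρ ^ 2 = ρ ^ 2 * (1 - σ) := by ring
    _ ≤ (1 + ρ) * (2 * τ) := hmain'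
    _ = τ * (2 * (1 + ρ)) := by ring

/-- **THE TWO-SIDED FLOOR**: with both level samplers uniformly minorised,
`max (σ ρ₀²/(2(1+ρ₀))) ((1 − σ) ρ₁²/(2(1+ρ₁))) ≤ τ_int(ρ_occ)`. -/
theorem CrooksPair.ncmc_tauInt_occupancy_ge_max_of_nHit (h : CrooksPair ν₀ ν₁ κF κR s e W)
    (h0 : ν₀ univ ≠ 0) (h1 : ν₁ univ ≠ 0) (hT₀ : Kernel.Invariant T₀ ν₀)
    (hT₁ : Kernel.Invariant T₁ ν₁) (hε : ε ≠ 0) (hm : 0 < m)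
    (hD : haveI := isMarkovKernel_switchKernel (κF := κF) (κR := κR) (c := c)
              h.measurable_W h.measurable_s h.measurable_e
      ∀ z, ε • ν ≤ nHit (switchKernel κF κR c W s e ∘ₖ levelKernel T₀ T₁) m z)
    {m₀ m₁ : Measure Ω} [IsFiniteMeasure m₀] [IsFiniteMeasure m₁] (hmin₀ : ∀ x, m₀ ≤ T₀ x)
    (hmin₁ : ∀ y, m₁ ≤ T₁ y)
    {ΔF : ℝ} (hΔF : Real.exp (-ΔF) = ((ν₀ univ)⁻¹ * ν₁ univ).toReal) :
    haveI := isMarkovKernel_switchKernel (κF := κF) (κR := κR) (c := c)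
      h.measurable_W h.measurable_s h.measurable_e
    max (Real.sigmoid (c - ΔF) * (∫⁻ x', (1 - fwdFlow κF c W e x' univ) ∂m₀).toReal ^ 2
          / (2 * (1 + (∫⁻ x', (1 - fwdFlow κF c W e x' univ) ∂m₀).toReal)))
        ((1 - Real.sigmoid (c - ΔF)) * (∫⁻ y', (1 - revFlow κR c W s y' univ) ∂m₁).toReal ^ 2
          / (2 * (1 + (∫⁻ y', (1 - revFlow κR c W s y' univ) ∂m₁).toReal)))
      ≤ Scoring.tauInt (setACF (switchKernel κF κR c W s e ∘ₖ levelKernel T₀ T₁)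
          ((jointWeight c ν₀ ν₁ univ)⁻¹ • jointWeight c ν₀ ν₁) (targetLevel Ω)) :=
  max_le (h.ncmc_tauInt_occupancy_ge_of_nHit h0 h1 hT₀ hT₁ hε hm hD hmin₀ hΔF)
    (h.ncmc_tauInt_occupancy_ge_target_of_nHit h0 h1 hT₀ hT₁ hε hm hD hmin₁ hΔF)

end Floor

end Summit.Ventures.LatticeQCDFlow.Exactness.GeneralNCMC
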